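import Summits.CriticalPhenomena.PercolationContinuityZ3.Theorems.PercNearOneGluingNoHeavyPcintKernZ6B4Defs
import HarnessLib

/-!
# PCINT lane, kernel check 2/4 of the B3r window certificate `d = 6`, memory 4 (3-step windows, 1728 codes): codes `432 ≤ c < 864`

Cell `prim-pcint`, seat `prim-pcint-2` (gen 2).  Collatz–Wielandt rows `10^5 · row ≤ 99999 · DEN · v` for the window codes in
`[432, 864)`, by `decide +kernel` in chunks of `54` codes (natural-number arithmetic only; `maxHeartbeats 0`).
Does NOT build on p205010.
-/

namespace Summit.CriticalPhenomena.PercolationContinuityZ3.Theorems.Pcint.Z6B4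

set_option maxHeartbeats 0 in
/-- Rows `432 ≤ c < 486` of the certificate hold. [folklore] -/
theorem chk_432_486 : WinK.allRange (WinK.rowOKB 6 2 923 10043 9958 99999 tbl 90539) 432 486 = true := by decide +kernel

set_option maxHeartbeats 0 in
/-- Rows `486 ≤ c < 540` of the certificate hold. [folklore] -/
theorem chk_486_540 : WinK.allRange (WinK.rowOKB 6 2 923 10043 9958 99999 tbl 90539) 486 540 = true := by decide +kernel

set_option maxHeartbeats 0 in
/-- Rows `540 ≤ c < 594` of the certificate hold. [folklore] -/
theorem chk_540_594 : WinK.allRange (WinK.rowOKB 6 2 923 10043 9958 99999 tbl 90539) 540 594 = true := by decide +kernel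

set_option maxHeartbeats 0 in
/-- Rows `594 ≤ c < 648` of the certificate hold. [folklore] -/
theorem chk_594_648 : WinK.allRange (WinK.rowOKB 6 2 923 10043 9958 99999 tbl 90539) 594 648 = true := by decide +kernel

set_option maxHeartbeats 0 in
/-- Rows `648 ≤ c < 702` of the certificate hold. [folklore] -/
theorem chk_648_702 : WinK.allRange (WinK.rowOKB 6 2 923 10043 9958 99999 tbl 90539) 648 702 = true := by decide +kernel

set_option maxHeartbeats 0 in
/-- Rows `702 ≤ c < 756` of the certificate hold. [folklore] -/
theorem chk_702_756 : WinK.allRange (WinK.rowOKB 6 2 923 10043 9958 99999 tbl 90539) 702 756 = true := by decide +kernel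

set_option maxHeartbeats 0 in
/-- Rows `756 ≤ c < 810` of the certificate hold. [folklore] -/
theorem chk_756_810 : WinK.allRange (WinK.rowOKB 6 2 923 10043 9958 99999 tbl 90539) 756 810 = true := by decide +kernel

set_option maxHeartbeats 0 in
/-- Rows `810 ≤ c < 864` of the certificate hold. [folklore] -/
theorem chk_810_864 : WinK.allRange (WinK.rowOKB 6 2 923 10043 9958 99999 tbl 90539) 810 864 = true := by decide +kernel

/-- Rows `432 ≤ c < 864` of the certificate hold. [folklore] -/
theorem chkFile_2 : WinK.allRange (WinK.rowOKB 6 2 923 10043 9958 99999 tbl 90539) 432 864 = true :=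
  chk_split (chk_split (chk_split (chk_split (chk_split (chk_split (chk_split chk_432_486 chk_486_540) chk_540_594) chk_594_648) chk_648_702) chk_702_756) chk_756_810) chk_810_864

end Summit.CriticalPhenomena.PercolationContinuityZ3.Theorems.Pcint.Z6B4
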